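import Summits.HubbardSuperconductivity.HubbardSuperconductivity.Theorems.SgAnchorOrder.Negative.PairFibre

/-!
# `SgAnchorOrder` (route `ColourTheSpin`, stmt-HubbardSuperconductivity-16273) — negative lane, file 3/3:
# strong-coupling freezing — the `O(L²)` pair ceiling and the existence of block ground states

`Re⟨v,Hv⟩ = -⟨hop⟩ + U⟨n↑n↓⟩ + g²⟨E⟩ + g⁻²⟨V⟩` with the first, second and fourth forms bounded by
`C₁(L,U)‖v‖²` and the electric form `= Σ_b ‖v - Q_bv‖²`, vanishing on the trial state `|s₀⟩ ⊗ const`; so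
a ground state of the `N_L`-block at `g ≥ 1` has `E ≤ C₁` and `g² Σ_b‖ψ - Q_bψ‖² ≤ 2C₁‖ψ‖²`, and
`pair_bound` gives **`⟨ψ,(Δ_d^g†Δ_d^g)_B ψ⟩ ≤ 33 L² ‖ψ‖²` for `g ≥ 1 + 192L²√(2C₁)`** (`ceiling_lit`).
`gs_lit`: every `N_L`-block has a normalised ground state (`FinDimSpectrumProofs`). Both are stated
for an ARBITRARY decidability instance of the block predicate, so that they apply verbatim to the
crux's inlined `let` block. Support lemmas for `ColourTheSpinSgAnchorOrder_refuted`.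
-/

noncomputable section

set_option linter.dupNamespace false

namespace Summit.HubbardSuperconductivity.HubbardSuperconductivity.Theorems

namespace ColourTheSpinSgAnchorOrderRefutation

open scoped BigOperators Matrix ComplexConjugate ComplexOrder
open Literature.MathematicalPhysics.QuantumLattice

/-! ### Part D — energetics: the electric form of a ground state is `O_{L,U}(g⁻²)` -/

section Model

open SpinGauged GaugedHubbard
open scoped Matrix.Norms.L2Operator Kronecker

variable (L : ℕ)

set_option quotPrecheck false in
local notation "𝒮" => Finset (Orb (FermionTorus 2 L))

/- The link averaging `Q_b ψ` (as an explicit function; no definition is introduced). -/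
set_option quotPrecheck false in
local notation:max "𝔸vg " b:max ψ:max =>
  (fun ik : Finset (Orb (FermionTorus 2 L)) × (GaugedHubbard.Bond L → Q8) =>
    (1 / (Fintype.card Q8 : ℂ)) * ∑ u : Q8, ψ (ik.1, Function.update ik.2 b u))

/- The electric quadratic form `Re ⟨v, (1 ⊗ Σ_b E_b) v⟩` (local notation). -/
set_option quotPrecheck false in
local notation:max "𝔼f " v:max =>
  (star v ⬝ᵥ ((1 : Matrix (Finset (Orb (FermionTorus 2 L))) (Finset (Orb (FermionTorus 2 L))) ℂ) ⊗ₖ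
    SpinGauged.electric (G := Q8) L) *ᵥ v).re

/- The trial vector: the occupation configuration `s₀` times the constant link function (local
notation). -/
set_option quotPrecheck false in
local notation:max "𝕋r " s₀:max =>
  (fun ik : SpinGauged.Index L Q8 => if ik.1 = s₀ then (1 : ℂ) else 0)

/- The particle number `N_L = 2⌊(1-δ)L²/2⌋` of the crux (local notation). -/
set_option quotPrecheck false in
local notation:max "ℕel " δ:max => (2 * ⌊(1 - δ) * (L : ℝ) ^ 2 / 2⌋₊)

/-- The electric form is the sum of the one-link Dirichlet forms. -/
theorem elecForm_eq_sum (v : Index L Q8 → ℂ) : 𝔼f v = ∑ b : Bond L, eucNorm (v - 𝔸vg b v) ^ 2 := by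
  have h : ((1 : Matrix 𝒮 𝒮 ℂ) ⊗ₖ SpinGauged.electric (G := Q8) L) *ᵥ v =
      ∑ b : Bond L, ((1 : Matrix 𝒮 𝒮 ℂ) ⊗ₖ SpinGauged.electricLink (G := Q8) L b) *ᵥ v := by
    funext ik
    obtain ⟨s, k⟩ := ik
    rw [one_kron_mulVec, SpinGauged.electric, Matrix.sum_mulVec, Finset.sum_apply, Finset.sum_apply]
    refine Finset.sum_congr rfl fun b _ => ?_
    rw [one_kron_mulVec]
  rw [h, dotProduct_sum, Complex.re_sum]
  refine Finset.sum_congr rfl fun b _ => ?_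
  exact dirichlet L b v

/-- One link's Dirichlet form is at most the electric form. [folklore] -/
theorem dirichlet_le_elecForm (v : Index L Q8 → ℂ) (b : Bond L) :
    eucNorm (v - 𝔸vg b v) ^ 2 ≤ 𝔼f v := by
  rw [elecForm_eq_sum]
  exact Finset.single_le_sum (f := fun b => eucNorm (v - 𝔸vg b v) ^ 2) (fun b _ => sq_nonneg _)
    (Finset.mem_univ b)

/-- The trial vector is constant along every link. [folklore] -/
theorem trial_update (s₀ s : 𝒮) (k : Bond L → Q8) (b : Bond L) (u : Q8) :
    (𝕋r s₀) (s, Function.update k b u) = (𝕋r s₀) (s, k) := rfl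

/-- The electric form vanishes on the trial vector. [folklore] -/
theorem elecForm_trial (s₀ : 𝒮) : 𝔼f (𝕋r s₀) = 0 := by
  rw [elecForm_eq_sum]
  refine Finset.sum_eq_zero fun b _ => ?_
  have h : 𝕋r s₀ - 𝔸vg b (𝕋r s₀) = 0 := by
    funext ik
    obtain ⟨s, k⟩ := ik
    rw [Pi.sub_apply, Pi.zero_apply]
    show (𝕋r s₀) (s, k) - (1 / (Fintype.card Q8 : ℂ)) * ∑ u : Q8, (𝕋r s₀) (s, Function.update k b u) = 0
    rw [Finset.sum_eq_card_nsmul (fun u _ => trial_update L s₀ s k b u),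
      Finset.card_univ, nsmul_eq_mul, ← mul_assoc,
      one_div_mul_cancel (card_G_ne_zero (G := Q8)), one_mul, sub_self]
  rw [h, eucNorm_zero]
  ring

/-- The trial vector has norm at least one. [folklore] -/
theorem one_le_eucNorm_trial (s₀ : 𝒮) : 1 ≤ eucNorm (𝕋r s₀) := by
  have h := norm_apply_le_eucNorm (𝕋r s₀) (s₀, fun _ => 1)
  dsimp only at h
  rwa [if_pos rfl, norm_one] at h

/-- The trial vector is supported on the configuration `s₀`. [folklore] -/
theorem trial_support (s₀ : 𝒮) (ik : Index L Q8) (h : ¬ ik.1 = s₀) : (𝕋r s₀) ik = 0 :=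
  if_neg h

/-- `|Bond L| = 2 L²`. [folklore] -/
theorem card_bond : (Fintype.card (Bond L) : ℝ) = 2 * (L : ℝ) ^ 2 := by
  have h : Fintype.card (Bond L) = L ^ 2 * 2 := by
    simp [FermionTorus, Fintype.card_lex, Fintype.card_prod, Fintype.card_fin]
  rw [h]
  push_cast
  ring

/-- There is an occupation configuration with `N_L` particles (`N_L ≤ 2L²`). [folklore] -/
theorem exists_card_eq_Nel (δ : ℝ) (hδ0 : 0 ≤ δ) (hδ1 : δ ≤ 1) : ∃ s₀ : 𝒮, s₀.card = ℕel δ := by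
  have hle : ℕel δ ≤ (Finset.univ : Finset (Orb (FermionTorus 2 L))).card := by
    have hc : Fintype.card (Orb (FermionTorus 2 L)) = L ^ 2 * 2 := by
      simp [FermionTorus, Fintype.card_lex, Fintype.card_prod, Fintype.card_fin]
    rw [Finset.card_univ, hc]
    have h1 : (⌊(1 - δ) * (L : ℝ) ^ 2 / 2⌋₊ : ℝ) ≤ (1 - δ) * (L : ℝ) ^ 2 / 2 :=
      Nat.floor_le (by have : (0:ℝ) ≤ 1 - δ := by linarith
                       positivity)
    have h2 : (1 - δ) * (L : ℝ) ^ 2 / 2 ≤ (L : ℝ) ^ 2 := by nlinarith [sq_nonneg (L : ℝ)]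
    have h3 : ((2 * ⌊(1 - δ) * (L : ℝ) ^ 2 / 2⌋₊ : ℕ) : ℝ) ≤ ((L ^ 2 * 2 : ℕ) : ℝ) := by
      push_cast
      nlinarith
    exact_mod_cast h3
  obtain ⟨t, -, ht⟩ := Finset.exists_subset_card_eq hle
  exact ⟨t, ht⟩

variable [NeZero L]

/- The crude constant `C₁(L, U)` bounding hopping, repulsion and magnetic forms (local notation). -/
set_option quotPrecheck false in
local notation "ℂ₁[" U "]" =>
  ((∑ i, ∑ j, ‖(SpinGauged.hop Q8.rep L + (SpinGauged.hop Q8.rep L)ᴴ) i j‖)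
    + |U| * (∑ i, ∑ j, ‖((∑ x : FermionTorus 2 L, numberOp x 0 * numberOp x 1 :
        Matrix (Finset (Orb (FermionTorus 2 L))) (Finset (Orb (FermionTorus 2 L))) ℂ) ⊗ₖ
          (1 : Matrix (Bond L → Q8) (Bond L → Q8) ℂ)) i j‖)
    + (∑ i, ∑ j, ‖((1 : Matrix (Finset (Orb (FermionTorus 2 L))) (Finset (Orb (FermionTorus 2 L))) ℂ) ⊗ₖ
        SpinGauged.magnetic Q8.rep L) i j‖))

/-- `C₁ ≥ 0`. [folklore] -/
theorem C1_nonneg (U : ℝ) : 0 ≤ ℂ₁[U] :=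
  add_nonneg (add_nonneg (sum_sum_norm_nonneg _) (mul_nonneg (abs_nonneg U) (sum_sum_norm_nonneg _)))
    (sum_sum_norm_nonneg _)

/-- Decomposition of the energy form into hopping, repulsion, electric and magnetic parts. [folklore] -/
theorem quadForm_ham (U g : ℝ) (v : Index L Q8 → ℂ) :
    (star v ⬝ᵥ spinGaugedHubbardTorus L U g *ᵥ v).re =
      -(star v ⬝ᵥ (SpinGauged.hop Q8.rep L + (SpinGauged.hop Q8.rep L)ᴴ) *ᵥ v).re
      + U * (star v ⬝ᵥ ((∑ x : FermionTorus 2 L, numberOp x 0 * numberOp x 1 :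
          Matrix 𝒮 𝒮 ℂ) ⊗ₖ (1 : Matrix (Bond L → Q8) (Bond L → Q8) ℂ)) *ᵥ v).re
      + g ^ 2 * 𝔼f v
      + (1 / g ^ 2) * (star v ⬝ᵥ ((1 : Matrix 𝒮 𝒮 ℂ) ⊗ₖ SpinGauged.magnetic Q8.rep L) *ᵥ v).re := by
  rw [spinGaugedHubbardTorus, spinGaugedHubbardTorusWith]
  simp only [Matrix.add_mulVec, Matrix.neg_mulVec, Matrix.smul_mulVec, dotProduct_add, dotProduct_neg,
    dotProduct_smul, smul_eq_mul, Complex.add_re, Complex.neg_re, Complex.re_ofReal_mul]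

/-- Lower bound of the energy form: `Re⟨v,Hv⟩ ≥ -C₁ ‖v‖² + g² ⟨E⟩` for `g ≥ 1`. -/
theorem quadForm_ham_ge (U g : ℝ) (hg : 1 ≤ g) (v : Index L Q8 → ℂ) :
    -(ℂ₁[U]) * eucNorm v ^ 2 + g ^ 2 * 𝔼f v ≤ (star v ⬝ᵥ spinGaugedHubbardTorus L U g *ᵥ v).re := by
  rw [quadForm_ham]
  have hT := abs_re_quadForm_le (SpinGauged.hop Q8.rep L + (SpinGauged.hop Q8.rep L)ᴴ) v
  have hD := abs_re_quadForm_le ((∑ x : FermionTorus 2 L, numberOp x 0 * numberOp x 1 :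
          Matrix 𝒮 𝒮 ℂ) ⊗ₖ (1 : Matrix (Bond L → Q8) (Bond L → Q8) ℂ)) v
  have hV := abs_re_quadForm_le ((1 : Matrix 𝒮 𝒮 ℂ) ⊗ₖ SpinGauged.magnetic Q8.rep L) v
  rw [abs_le] at hT hD hV
  have e2 : 0 ≤ eucNorm v ^ 2 := by positivity
  have hg2 : 1 ≤ g ^ 2 := by nlinarith
  have hginv : 0 < 1 / g ^ 2 := by positivity
  have hginv1 : 1 / g ^ 2 ≤ 1 := by rw [div_le_one (by positivity)]; exact hg2
  have hβV := sum_sum_norm_nonneg ((1 : Matrix 𝒮 𝒮 ℂ) ⊗ₖ SpinGauged.magnetic Q8.rep L)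
  have hβD := sum_sum_norm_nonneg ((∑ x : FermionTorus 2 L, numberOp x 0 * numberOp x 1 :
          Matrix 𝒮 𝒮 ℂ) ⊗ₖ (1 : Matrix (Bond L → Q8) (Bond L → Q8) ℂ))
  -- the `U` term
  have hU : -(|U| * ((∑ i, ∑ j, ‖((∑ x : FermionTorus 2 L, numberOp x 0 * numberOp x 1 :
          Matrix 𝒮 𝒮 ℂ) ⊗ₖ (1 : Matrix (Bond L → Q8) (Bond L → Q8) ℂ)) i j‖) * eucNorm v ^ 2)) ≤
      U * (star v ⬝ᵥ ((∑ x : FermionTorus 2 L, numberOp x 0 * numberOp x 1 :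
          Matrix 𝒮 𝒮 ℂ) ⊗ₖ (1 : Matrix (Bond L → Q8) (Bond L → Q8) ℂ)) *ᵥ v).re := by
    have h := abs_re_quadForm_le ((∑ x : FermionTorus 2 L, numberOp x 0 * numberOp x 1 :
          Matrix 𝒮 𝒮 ℂ) ⊗ₖ (1 : Matrix (Bond L → Q8) (Bond L → Q8) ℂ)) v
    have h2 : |U * (star v ⬝ᵥ ((∑ x : FermionTorus 2 L, numberOp x 0 * numberOp x 1 :
          Matrix 𝒮 𝒮 ℂ) ⊗ₖ (1 : Matrix (Bond L → Q8) (Bond L → Q8) ℂ)) *ᵥ v).re| ≤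
        |U| * ((∑ i, ∑ j, ‖((∑ x : FermionTorus 2 L, numberOp x 0 * numberOp x 1 :
          Matrix 𝒮 𝒮 ℂ) ⊗ₖ (1 : Matrix (Bond L → Q8) (Bond L → Q8) ℂ)) i j‖) * eucNorm v ^ 2) := by
      rw [abs_mul]
      exact mul_le_mul_of_nonneg_left h (abs_nonneg U)
    exact (abs_le.1 h2).1
  -- the magnetic term
  have hM : -((∑ i, ∑ j, ‖((1 : Matrix 𝒮 𝒮 ℂ) ⊗ₖ SpinGauged.magnetic Q8.rep L) i j‖) * eucNorm v ^ 2) ≤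
      (1 / g ^ 2) * (star v ⬝ᵥ ((1 : Matrix 𝒮 𝒮 ℂ) ⊗ₖ SpinGauged.magnetic Q8.rep L) *ᵥ v).re := by
    have h3 : (1 / g ^ 2) * (-((∑ i, ∑ j, ‖((1 : Matrix 𝒮 𝒮 ℂ) ⊗ₖ SpinGauged.magnetic Q8.rep L) i j‖) *
        eucNorm v ^ 2)) ≤ (1 / g ^ 2) * (star v ⬝ᵥ ((1 : Matrix 𝒮 𝒮 ℂ) ⊗ₖ
          SpinGauged.magnetic Q8.rep L) *ᵥ v).re := mul_le_mul_of_nonneg_left hV.1 hginv.le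
    nlinarith
  nlinarith [hT.2]

/-- Upper bound of the energy form on a vector killed by the electric term (`g ≥ 1`). -/
theorem quadForm_ham_le (U g : ℝ) (hg : 1 ≤ g) (v : Index L Q8 → ℂ) (hv : 𝔼f v = 0) :
    (star v ⬝ᵥ spinGaugedHubbardTorus L U g *ᵥ v).re ≤ ℂ₁[U] * eucNorm v ^ 2 := by
  rw [quadForm_ham, hv, mul_zero, add_zero]
  have hT := abs_re_quadForm_le (SpinGauged.hop Q8.rep L + (SpinGauged.hop Q8.rep L)ᴴ) v
  have hD := abs_re_quadForm_le ((∑ x : FermionTorus 2 L, numberOp x 0 * numberOp x 1 :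
          Matrix 𝒮 𝒮 ℂ) ⊗ₖ (1 : Matrix (Bond L → Q8) (Bond L → Q8) ℂ)) v
  have hV := abs_re_quadForm_le ((1 : Matrix 𝒮 𝒮 ℂ) ⊗ₖ SpinGauged.magnetic Q8.rep L) v
  rw [abs_le] at hT hV
  have e2 : 0 ≤ eucNorm v ^ 2 := by positivity
  have hg2 : 1 ≤ g ^ 2 := by nlinarith
  have hginv : 0 < 1 / g ^ 2 := by positivity
  have hginv1 : 1 / g ^ 2 ≤ 1 := by rw [div_le_one (by positivity)]; exact hg2
  have hβV := sum_sum_norm_nonneg ((1 : Matrix 𝒮 𝒮 ℂ) ⊗ₖ SpinGauged.magnetic Q8.rep L)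
  have hU : U * (star v ⬝ᵥ ((∑ x : FermionTorus 2 L, numberOp x 0 * numberOp x 1 :
          Matrix 𝒮 𝒮 ℂ) ⊗ₖ (1 : Matrix (Bond L → Q8) (Bond L → Q8) ℂ)) *ᵥ v).re ≤
      |U| * ((∑ i, ∑ j, ‖((∑ x : FermionTorus 2 L, numberOp x 0 * numberOp x 1 :
          Matrix 𝒮 𝒮 ℂ) ⊗ₖ (1 : Matrix (Bond L → Q8) (Bond L → Q8) ℂ)) i j‖) * eucNorm v ^ 2) := by
    have h2 : |U * (star v ⬝ᵥ ((∑ x : FermionTorus 2 L, numberOp x 0 * numberOp x 1 :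
          Matrix 𝒮 𝒮 ℂ) ⊗ₖ (1 : Matrix (Bond L → Q8) (Bond L → Q8) ℂ)) *ᵥ v).re| ≤
        |U| * ((∑ i, ∑ j, ‖((∑ x : FermionTorus 2 L, numberOp x 0 * numberOp x 1 :
          Matrix 𝒮 𝒮 ℂ) ⊗ₖ (1 : Matrix (Bond L → Q8) (Bond L → Q8) ℂ)) i j‖) * eucNorm v ^ 2) := by
      rw [abs_mul]
      exact mul_le_mul_of_nonneg_left hD (abs_nonneg U)
    exact (abs_le.1 h2).2
  have hM : (1 / g ^ 2) * (star v ⬝ᵥ ((1 : Matrix 𝒮 𝒮 ℂ) ⊗ₖ SpinGauged.magnetic Q8.rep L) *ᵥ v).re ≤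
      (∑ i, ∑ j, ‖((1 : Matrix 𝒮 𝒮 ℂ) ⊗ₖ SpinGauged.magnetic Q8.rep L) i j‖) * eucNorm v ^ 2 := by
    have h3 : (1 / g ^ 2) * (star v ⬝ᵥ ((1 : Matrix 𝒮 𝒮 ℂ) ⊗ₖ
          SpinGauged.magnetic Q8.rep L) *ᵥ v).re ≤ (1 / g ^ 2) * ((∑ i, ∑ j, ‖((1 : Matrix 𝒮 𝒮 ℂ) ⊗ₖ
          SpinGauged.magnetic Q8.rep L) i j‖) * eucNorm v ^ 2) := mul_le_mul_of_nonneg_left hV.2 hginv.le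
    nlinarith
  nlinarith [hT.1]

/-! ### Part E — the pair ceiling and the existence of ground states (literature form) -/

/-- **The `O(L²)` pair ceiling at the frozen end.** For `g ≥ G(L, U)` every ground state `ψ` of the
`N_L`-block of `H_g(L, U)` has `⟨ψ, (Δ_d^g† Δ_d^g)_B ψ⟩ ≤ 33 L² ‖ψ‖²`. -/
theorem ceiling_lit (U δ : ℝ) (hδ : δ ∈ Set.Ioo (0 : ℝ) (1 / 2)) :
    ∃ G : ℝ, ∀ g : ℝ, G ≤ g → ∀ (p : SpinGauged.Index L Q8 → Prop) {instD : DecidablePred p},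
      p = SpinGauged.HasParticleNumber L (ℕel δ) → ∀ ψ : {ik // p ik} → ℂ,
      (ψ ≠ 0 ∧ ∃ E : ℝ, (spinGaugedHubbardTorus L U g).toBlock p p *ᵥ ψ = (E : ℂ) • ψ ∧
        ∀ φ : {ik // p ik} → ℂ, E * (star φ ⬝ᵥ φ).re ≤
          (star φ ⬝ᵥ (spinGaugedHubbardTorus L U g).toBlock p p *ᵥ φ).re) →
        (star ψ ⬝ᵥ ((spinGaugedPairField L)ᴴ * spinGaugedPairField L).toBlock p p *ᵥ ψ).re ≤
          33 * (L : ℝ) ^ 2 * (star ψ ⬝ᵥ ψ).re := by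
  set C := ℂ₁[U] with hC
  have hC0 : 0 ≤ C := by rw [hC]; exact C1_nonneg L U
  -- the two energy bounds, with the constant abstracted (keeps the context small for `linarith`)
  have hle : ∀ g : ℝ, 1 ≤ g → ∀ w : Index L Q8 → ℂ, 𝔼f w = 0 →
      (star w ⬝ᵥ spinGaugedHubbardTorus L U g *ᵥ w).re ≤ C * eucNorm w ^ 2 := by
    intro g hg w hw
    rw [hC]
    exact quadForm_ham_le L U g hg w hw
  have hge : ∀ g : ℝ, 1 ≤ g → ∀ w : Index L Q8 → ℂ,
      -C * eucNorm w ^ 2 + g ^ 2 * 𝔼f w ≤ (star w ⬝ᵥ spinGaugedHubbardTorus L U g *ᵥ w).re := by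
    intro g hg w
    rw [hC]
    exact quadForm_ham_ge L U g hg w
  clear_value C
  clear hC
  refine ⟨1 + 192 * (L : ℝ) ^ 2 * Real.sqrt (2 * C), fun g hg p instD hp ψ hψ => ?_⟩
  subst hp
  obtain ⟨hψ0, E, hE, hmin⟩ := hψ
  -- numerology of `g`
  have hL1 : (1 : ℝ) ≤ (L : ℝ) := by exact_mod_cast Nat.one_le_iff_ne_zero.2 (NeZero.ne L)
  have hL2 : (1 : ℝ) ≤ (L : ℝ) ^ 2 := by nlinarith
  have hsq0 : 0 ≤ Real.sqrt (2 * C) := Real.sqrt_nonneg _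
  have hg1 : 1 ≤ g := by nlinarith
  have hg0 : 0 < g := by linarith
  set θ : ℝ := Real.sqrt (2 * C) / g with hθ
  have hθ0 : 0 ≤ θ := by positivity
  have hθL : 192 * (L : ℝ) ^ 2 * θ ≤ 1 := by
    rw [hθ, mul_div_assoc', div_le_one hg0]
    linarith
  have hθ1 : θ ≤ 1 := by nlinarith
  -- the full-space vector
  set v := Function.extend Subtype.val ψ 0 with hv
  have hnorm : (star ψ ⬝ᵥ ψ).re = eucNorm v ^ 2 := by rw [block_norm, eucNorm_sq]
  -- (a) `E ‖v‖² = Re ⟨v, H v⟩`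
  have hEv : (star v ⬝ᵥ spinGaugedHubbardTorus L U g *ᵥ v).re = E * eucNorm v ^ 2 := by
    rw [← hnorm, hv, ← block_form, hE, dotProduct_smul, smul_eq_mul, Complex.re_ofReal_mul]
  -- (b) `E ≤ C₁` by the trial state
  obtain ⟨s₀, hs₀⟩ := exists_card_eq_Nel L δ hδ.1.le (by linarith [hδ.2])
  have htrial_supp : ∀ ik : Index L Q8, ¬ SpinGauged.HasParticleNumber L (ℕel δ) ik → (𝕋r s₀) ik = 0 := by
    intro ik hik
    apply trial_support
    intro h
    exact hik (by rw [SpinGauged.HasParticleNumber, h, hs₀])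
  have hEle : E ≤ C := by
    have h1 := hmin (fun a => (𝕋r s₀) a.1)
    rw [block_form, block_norm, extend_val_restrict _ htrial_supp] at h1
    rw [← eucNorm_sq] at h1
    have h2 := hle g hg1 (𝕋r s₀) (elecForm_trial L s₀)
    have h3 := one_le_eucNorm_trial L s₀
    have h4 : 0 < eucNorm (𝕋r s₀) ^ 2 := by positivity
    exact le_of_mul_le_mul_right (h1.trans h2) h4
  -- (c) the electric form is small
  set El := 𝔼f v with hEl
  have h := hge g hg1 v
  rw [hEv, ← hEl] at h
  have hdl : ∀ b : Bond L, eucNorm (v - 𝔸vg b v) ^ 2 ≤ El := fun b => by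
    rw [hEl]
    exact dirichlet_le_elecForm L v b
  clear_value El
  clear hEl
  have helec : g ^ 2 * El ≤ 2 * C * eucNorm v ^ 2 := by
    have e2 : 0 ≤ eucNorm v ^ 2 := by positivity
    nlinarith [mul_le_mul_of_nonneg_right hEle e2]
  -- (d) every link is `θ`-close to its average
  have hlink : ∀ b : Bond L, eucNorm (v - 𝔸vg b v) ≤ θ * eucNorm v := by
    intro b
    have h1 := hdl b
    have h2 : eucNorm (v - 𝔸vg b v) ^ 2 ≤ (θ * eucNorm v) ^ 2 := by
      have hg2 : 0 < g ^ 2 := by positivity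
      have : El ≤ 2 * C / g ^ 2 * eucNorm v ^ 2 := by
        rw [div_mul_eq_mul_div, le_div_iff₀ hg2]
        linarith
      calc eucNorm (v - 𝔸vg b v) ^ 2 ≤ 2 * C / g ^ 2 * eucNorm v ^ 2 := h1.trans this
        _ = (θ * eucNorm v) ^ 2 := by
            rw [hθ, mul_pow, div_pow, Real.sq_sqrt (by positivity)]
    nlinarith [h2, eucNorm_nonneg (v - 𝔸vg b v), mul_nonneg hθ0 (eucNorm_nonneg v)]
  -- (e) the pair bound
  have hpair := pair_bound L v θ hθ0 hθ1 hlink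
  have hgoal : (star ψ ⬝ᵥ ((spinGaugedPairField L)ᴴ * spinGaugedPairField L).toBlock
      (SpinGauged.HasParticleNumber L (ℕel δ)) (SpinGauged.HasParticleNumber L (ℕel δ)) *ᵥ ψ).re =
        eucNorm (spinGaugedPairField L *ᵥ v) ^ 2 := by
    rw [block_form, re_quadForm_conjTranspose_mul_self]
  rw [hgoal, hnorm]
  have e2 : 0 ≤ eucNorm v ^ 2 := by positivity
  have hcoef : 16 * (Fintype.card (Bond L) : ℝ) + 48 * θ * (Fintype.card (Bond L) : ℝ) ^ 2 ≤
      33 * (L : ℝ) ^ 2 := by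
    rw [card_bond]
    have h1 : 48 * θ * (2 * (L : ℝ) ^ 2) ^ 2 = (192 * (L : ℝ) ^ 2 * θ) * (L : ℝ) ^ 2 := by ring
    have h2 : (192 * (L : ℝ) ^ 2 * θ) * (L : ℝ) ^ 2 ≤ 1 * (L : ℝ) ^ 2 :=
      mul_le_mul_of_nonneg_right hθL (by positivity)
    nlinarith
  exact hpair.trans (mul_le_mul_of_nonneg_right hcoef e2)

/-- **A normalised ground state of the `N_L`-block exists** (Hermitian block on a non-empty index type; the bottom eigenvector minimises the Rayleigh quotient), for any decidability instance of the block predicate. [folklore] -/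
theorem gs_lit (U δ g : ℝ) (hδ : δ ∈ Set.Ioo (0 : ℝ) (1 / 2)) (p : SpinGauged.Index L Q8 → Prop)
    {instD : DecidablePred p} (hp : p = SpinGauged.HasParticleNumber L (ℕel δ)) :
    ∃ ψ : {ik // p ik} → ℂ, star ψ ⬝ᵥ ψ = 1 ∧ (ψ ≠ 0 ∧ ∃ E : ℝ,
      (spinGaugedHubbardTorus L U g).toBlock p p *ᵥ ψ = (E : ℂ) • ψ ∧
        ∀ φ : {ik // p ik} → ℂ, E * (star φ ⬝ᵥ φ).re ≤
          (star φ ⬝ᵥ (spinGaugedHubbardTorus L U g).toBlock p p *ᵥ φ).re) := by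
  subst hp
  obtain ⟨s₀, hs₀⟩ := exists_card_eq_Nel L δ hδ.1.le (by linarith [hδ.2])
  haveI : Nonempty {ik // SpinGauged.HasParticleNumber (G := Q8) L (ℕel δ) ik} :=
    ⟨⟨(s₀, fun _ => (1 : Q8)), hs₀⟩⟩
  have hB : ((spinGaugedHubbardTorus L U g).toBlock (SpinGauged.HasParticleNumber L (ℕel δ))
      (SpinGauged.HasParticleNumber L (ℕel δ))).IsHermitian :=
    (isHermitian_spinGaugedHubbardTorus L U g).submatrix _
  set B := (spinGaugedHubbardTorus L U g).toBlock (SpinGauged.HasParticleNumber L (ℕel δ))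
      (SpinGauged.HasParticleNumber L (ℕel δ)) with hBdef
  obtain ⟨φ, hφ, hφ0⟩ := (Submodule.ne_bot_iff _).1 (Matrix.groundSpace_ne_bot_holds hB)
  rw [Matrix.mem_groundSpace_iff] at hφ
  obtain ⟨c, hc0, hc1⟩ := exists_smul_unit hφ0
  refine ⟨c • φ, hc1, ?_, B.groundEnergy, ?_, ?_⟩
  · intro h
    exact hφ0 ((smul_eq_zero.1 h).resolve_left hc0)
  · rw [Matrix.mulVec_smul, hφ, smul_comm]
  · intro φ'
    by_cases h0 : φ' = 0
    · simp [h0]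
    · obtain ⟨c', hc'0, hc'1⟩ := exists_smul_unit h0
      have h := Matrix.groundEnergy_le_rayleigh_holds hB (c' • φ') hc'1
      have hq : (star (c' • φ') ⬝ᵥ B *ᵥ (c' • φ')) = ((‖c'‖ ^ 2 : ℝ) : ℂ) * (star φ' ⬝ᵥ B *ᵥ φ') := by
        rw [Matrix.mulVec_smul, star_smul, smul_dotProduct, dotProduct_smul, smul_smul, smul_eq_mul,
          Complex.star_def, Complex.conj_mul']
        push_cast
        ring
      have hn : (star (c' • φ') ⬝ᵥ (c' • φ')) = ((‖c'‖ ^ 2 : ℝ) : ℂ) * (star φ' ⬝ᵥ φ') := by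
        rw [star_smul, smul_dotProduct, dotProduct_smul, smul_smul, smul_eq_mul, Complex.star_def,
          Complex.conj_mul']
        push_cast
        ring
      rw [hq, Complex.re_ofReal_mul] at h
      have h1 : ‖c'‖ ^ 2 * (star φ' ⬝ᵥ φ').re = 1 := by
        have := congrArg Complex.re hc'1
        rwa [hn, Complex.re_ofReal_mul, Complex.one_re] at this
      have hpos : 0 < (star φ' ⬝ᵥ φ').re := by
        have := Complex.pos_iff.mp (Matrix.dotProduct_star_self_pos_iff.2 h0)
        exact this.1
      have h2 : ‖c'‖ ^ 2 * (star φ' ⬝ᵥ B *ᵥ φ').re * (star φ' ⬝ᵥ φ').re = (star φ' ⬝ᵥ B *ᵥ φ').re := by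
        rw [mul_comm (‖c'‖ ^ 2), mul_assoc, h1, mul_one]
      nlinarith [mul_le_mul_of_nonneg_right h hpos.le]

end Model

end ColourTheSpinSgAnchorOrderRefutation

end Summit.HubbardSuperconductivity.HubbardSuperconductivity.Theorems
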